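import Literature.Topology.Euclidean.BrowderContinuation
import Mathlib.Analysis.InnerProductSpace.Dual
import Mathlib.Analysis.InnerProductSpace.PiL2
import Mathlib.Topology.Algebra.Module.FiniteDimension

/-!
# Route WindLine — support item `WindLineReachesCalm` (stmt-AnomalousDissipation-11420), I:
# continuation of zeros of a coercive parametrised vector field (Browder / Leray–Schauder, finite dimension)

Helper file (no route declaration is asserted here). The topological engine of the proof of
`WindLineReachesCalm`: a finite-dimensional continuation principle for ZEROS, obtained from the tree's
Browder continuation theorem for FIXED POINTS (`Literature.Topology.Euclidean.Browder.exists_isConnected_fixedPoints`,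
Browder 1960 / Solan–Solan 2023) by the radial-retraction trick.

* `eq_zero_of_retract_add_eq` — in a real inner product space, if `ξ` is a fixed point of
  `ξ ↦ ρ_R (ξ + v)` (`ρ_R y = (R / max R ‖y‖) • y` the radial retraction onto the closed `R`-ball) and
  `⟪v, ξ⟫ ≤ 0` whenever `‖ξ‖ = R`, then `v = 0`.
* `exists_isConnected_zeros_of_bilin_coercive` — **continuation of zeros**: `X` a finite-dimensional real
  normed space with a positive definite bilinear form `B`, `V : ℝ → X → X` jointly continuous with
  `B (V s x) x ≤ 0` whenever `s ∈ [a, b]` and `r ≤ B x x` (the field points inward outside a `B`-ball). Then the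
  zero set `{(s, x) : s ∈ [a, b], V s x = 0}` contains a connected set whose `s`-projection is all of `[a, b]`.
  (Leray–Schauder continuation in finite dimensions; here: Euclidean coordinates `Φ : ℝⁿ ≃L X`, pull back
  through the `B`-adjoint exactly as in the tree's `Brouwer.exists_zero_of_bilin_coercive`, and apply
  Browder's theorem to the box self-map `(s, ξ) ↦ (s, ρ_R (ξ + P s ξ))`, whose fixed points are zeros.)

References: F. E. Browder, Summa Brasil. Math. 4 (1960) 183–191; E. Solan, O. N. Solan, Amer. Math. Monthly
130 (2023) 370–374 (tree file `Literature/Topology/Euclidean/BrowderContinuation.lean`); J. Leray, J. Schauder,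
Ann. Sci. ÉNS 51 (1934) 45–78 (the continuation principle). Everything below is folklore given Browder's theorem.
-/

-- `Summit.<Summit>.<Problem>` is the tree's mandated summit-side namespace (CONVENTIONS §2); for this
-- single-conjunct summit the two coincide, so the duplicate is deliberate.
set_option linter.dupNamespace false

noncomputable section

open Metric Set

namespace Summit.AnomalousDissipation.AnomalousDissipation.Theorems.WindLineReachesCalm

/-! ## §1 The radial retraction `y ↦ (R / max R ‖y‖) • y` -/

section Retraction

variable {E : Type*} [NormedAddCommGroup E] [NormedSpace ℝ E]

/-- The radial retraction is continuous (`max R ‖y‖ ≥ R > 0`). [folklore] -/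
theorem continuous_retract {R : ℝ} (hR : 0 < R) :
    Continuous fun y : E => (R / max R ‖y‖) • y := by
  refine Continuous.smul ?_ continuous_id
  exact continuous_const.div (continuous_const.max continuous_norm) fun y =>
    (lt_of_lt_of_le hR (le_max_left _ _)).ne'

/-- The radial retraction takes values in the closed ball of radius `R`. [folklore] -/
theorem norm_retract_le {R : ℝ} (hR : 0 < R) (y : E) : ‖(R / max R ‖y‖) • y‖ ≤ R := by
  have hm : 0 < max R ‖y‖ := lt_of_lt_of_le hR (le_max_left _ _)
  rw [norm_smul, norm_div, Real.norm_of_nonneg hR.le, Real.norm_of_nonneg hm.le,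
    div_mul_eq_mul_div, div_le_iff₀ hm]
  exact mul_le_mul_of_nonneg_left (le_max_right _ _) hR.le

/-- The radial retraction is the identity on the closed ball of radius `R`. [folklore] -/
theorem retract_of_norm_le {R : ℝ} (hR : 0 < R) {y : E} (hy : ‖y‖ ≤ R) :
    (R / max R ‖y‖) • y = y := by
  rw [max_eq_left hy, div_self hR.ne', one_smul]

/-- **Fixed points of the retracted perturbation are zeros.** In a real inner product space let
`ρ_R (ξ + v) = ξ` for the radial retraction `ρ_R` onto the closed `R`-ball (`R > 0`), and suppose
`⟪v, ξ⟫ ≤ 0` in case `‖ξ‖ = R`. Then `v = 0`: either `ξ + v` lies in the ball and `ξ + v = ξ`, or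
`ξ = t (ξ + v)` with `0 < t < 1`, so `‖ξ‖ = R` and `⟪v, ξ⟫ = (1 - t) t ‖ξ + v‖² > 0`. [folklore] -/
theorem eq_zero_of_retract_add_eq {F : Type*} [NormedAddCommGroup F] [InnerProductSpace ℝ F]
    {R : ℝ} (hR : 0 < R) {ξ v : F}
    (hfix : (R / max R ‖ξ + v‖) • (ξ + v) = ξ) (hsign : ‖ξ‖ = R → inner ℝ v ξ ≤ 0) : v = 0 := by
  by_cases hle : ‖ξ + v‖ ≤ R
  · rw [retract_of_norm_le hR hle] at hfix
    exact add_eq_left.1 hfix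
  · push Not at hle
    have hy : 0 < ‖ξ + v‖ := hR.trans hle
    rw [max_eq_right hle.le] at hfix
    set t : ℝ := R / ‖ξ + v‖ with ht
    have ht0 : 0 < t := div_pos hR hy
    have ht1 : t < 1 := (div_lt_one hy).2 hle
    have hv : v = (1 - t) • (ξ + v) := by
      rw [sub_smul, one_smul, hfix, add_sub_cancel_left]
    have hnorm : ‖ξ‖ = R := by
      rw [← hfix, norm_smul, Real.norm_of_nonneg ht0.le, ht, div_mul_cancel₀ _ hy.ne']
    have hinner : inner ℝ v ξ = (1 - t) * t * ‖ξ + v‖ ^ 2 := by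
      have e1 : inner ℝ v ξ = inner ℝ ((1 - t) • (ξ + v)) (t • (ξ + v)) := by
        rw [← hv, hfix]
      rw [e1, real_inner_smul_left, real_inner_smul_right, real_inner_self_eq_norm_sq]
      ring
    have hpos : 0 < (1 - t) * t * ‖ξ + v‖ ^ 2 := by
      have : 0 < 1 - t := sub_pos.2 ht1
      positivity
    have h := hsign hnorm
    rw [hinner] at h
    exact absurd h (not_le.2 hpos)

end Retraction

/-! ## §2 Continuation of zeros -/

section Continuation

variable {X : Type*} [NormedAddCommGroup X] [NormedSpace ℝ X] [FiniteDimensional ℝ X]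

/-- **Continuation of zeros of a coercive parametrised field** (Leray–Schauder continuation in finite
dimensions, from Browder's theorem). Let `X` be a finite-dimensional real normed space, `B` a positive
definite bilinear form on `X`, and `V : ℝ → X → X` jointly continuous with `B (V s x) x ≤ 0` whenever
`s ∈ [a, b]` (`a ≤ b`) and `r ≤ B x x`. Then there is a connected set `K` of zeros,
`K ⊆ {(s, x) : s ∈ [a, b], V s x = 0}`, whose projection to the parameter is the whole interval `[a, b]`.
Proof: in Euclidean coordinates `Φ : ℝⁿ ≃L X` with the pulled-back field
`P s = Riesz⁻¹ (ζ ↦ B (V s (Φ ·)) (Φ ζ))` (`⟪P s ξ, ξ⟫ ≤ 0` on a large sphere `‖ξ‖ = R` by compactness of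
the unit sphere), the map `(s, ξ) ↦ (s, ρ_R (ξ + P s ξ))` is a continuous self-map of the box
`[a, b] × [-R, R]ⁿ` preserving the parameter; Browder's theorem
(`Browder.exists_isConnected_fixedPoints`) gives a connected set of fixed points projecting onto
`[a, b]`, and fixed points are zeros (`eq_zero_of_retract_add_eq`, definiteness of `B`). [folklore] -/
theorem exists_isConnected_zeros_of_bilin_coercive (B : X →ₗ[ℝ] X →ₗ[ℝ] ℝ)
    (hB : ∀ x, x ≠ 0 → 0 < B x x) {V : ℝ → X → X}
    (hV : Continuous fun p : ℝ × X => V p.1 p.2) {a b r : ℝ} (hab : a ≤ b)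
    (hcoer : ∀ s ∈ Icc a b, ∀ x, r ≤ B x x → B (V s x) x ≤ 0) :
    ∃ K : Set (ℝ × X), K ⊆ {p | p.1 ∈ Icc a b ∧ V p.1 p.2 = 0} ∧ IsConnected K ∧
      Prod.fst '' K = Icc a b := by
  rcases subsingleton_or_nontrivial X with hX | hX
  · refine ⟨(fun s => (s, (0 : X))) '' Icc a b, ?_, ?_, ?_⟩
    · rintro _ ⟨s, hs, rfl⟩
      exact ⟨hs, Subsingleton.elim _ _⟩
    · exact (isConnected_Icc hab).image _
        (continuous_id.prodMk continuous_const).continuousOn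
    · rw [Set.image_image]
      simp
  -- Euclidean coordinates
  set n : ℕ := Module.finrank ℝ X with hn
  have hfin : Module.finrank ℝ (EuclideanSpace ℝ (Fin n)) = Module.finrank ℝ X := by
    rw [finrank_euclideanSpace_fin]
  set Φ : EuclideanSpace ℝ (Fin n) ≃L[ℝ] X := ContinuousLinearEquiv.ofFinrankEq hfin with hΦ
  haveI : Nontrivial (EuclideanSpace ℝ (Fin n)) := Φ.toEquiv.nontrivial
  -- the `B`-adjoint functional `y ↦ (ζ ↦ B y (Φ ζ))`
  set M : X →ₗ[ℝ] (EuclideanSpace ℝ (Fin n) →L[ℝ] ℝ) :=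
    (LinearMap.toContinuousLinearMap :
        (EuclideanSpace ℝ (Fin n) →ₗ[ℝ] ℝ) ≃ₗ[ℝ] (EuclideanSpace ℝ (Fin n) →L[ℝ] ℝ)).toLinearMap ∘ₗ
      (LinearMap.lcomp ℝ ℝ (Φ : EuclideanSpace ℝ (Fin n) →ₗ[ℝ] X)) ∘ₗ B with hM
  have hMapply : ∀ (y : X) (ζ : EuclideanSpace ℝ (Fin n)), M y ζ = B y (Φ ζ) := by
    intro y ζ
    simp [hM]
  have hMc : Continuous M := M.continuous_of_finiteDimensional
  -- the pulled-back parametrised field (packaged as an existential, so that it stays opaque)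
  obtain ⟨P, hPc, hPinner⟩ : ∃ P : ℝ → EuclideanSpace ℝ (Fin n) → EuclideanSpace ℝ (Fin n),
      (Continuous fun p : ℝ × EuclideanSpace ℝ (Fin n) => P p.1 p.2) ∧
        ∀ (s : ℝ) (ξ ζ : EuclideanSpace ℝ (Fin n)), inner ℝ (P s ξ) ζ = B (V s (Φ ξ)) (Φ ζ) := by
    refine ⟨fun s ξ => (InnerProductSpace.toDual ℝ (EuclideanSpace ℝ (Fin n))).symm (M (V s (Φ ξ))),
      (InnerProductSpace.toDual ℝ (EuclideanSpace ℝ (Fin n))).symm.continuous.comp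
        (hMc.comp (hV.comp (continuous_fst.prodMk (Φ.continuous.comp continuous_snd)))),
      fun s ξ ζ => ?_⟩
    dsimp only
    rw [InnerProductSpace.toDual_symm_apply, hMapply]
  -- the quadratic form `q ξ = B (Φ ξ) (Φ ξ)` is bounded below by `m ‖ξ‖²`, `m > 0`
  set q : EuclideanSpace ℝ (Fin n) → ℝ := fun ξ => B (Φ ξ) (Φ ξ) with hq
  have hqc : Continuous q := by
    have h1 : Continuous fun ξ : EuclideanSpace ℝ (Fin n) => M (Φ ξ) := hMc.comp Φ.continuous
    have h2 : Continuous fun ξ : EuclideanSpace ℝ (Fin n) => M (Φ ξ) ξ := h1.clm_apply continuous_id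
    simpa only [hMapply] using h2
  obtain ⟨ξ₀, hξ₀, hmin⟩ := (isCompact_sphere (0 : EuclideanSpace ℝ (Fin n)) 1).exists_isMinOn
    (NormedSpace.sphere_nonempty.2 zero_le_one) hqc.continuousOn
  set m : ℝ := q ξ₀ with hm
  have hξ₀ne : ξ₀ ≠ 0 := by
    intro h
    rw [h, mem_sphere_zero_iff_norm, norm_zero] at hξ₀
    exact zero_ne_one hξ₀
  have hm_pos : 0 < m := hB (Φ ξ₀) (by simpa using hξ₀ne)
  have hq_lower : ∀ ξ : EuclideanSpace ℝ (Fin n), m * ‖ξ‖ ^ 2 ≤ q ξ := by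
    intro ξ
    by_cases hξ : ξ = 0
    · subst hξ
      simp [hq]
    · have hnξ : 0 < ‖ξ‖ := norm_pos_iff.2 hξ
      set η : EuclideanSpace ℝ (Fin n) := ‖ξ‖⁻¹ • ξ with hη
      have hηs : η ∈ sphere (0 : EuclideanSpace ℝ (Fin n)) 1 := by
        rw [mem_sphere_zero_iff_norm, hη, norm_smul, norm_inv, norm_norm,
          inv_mul_cancel₀ hnξ.ne']
      have hle : m ≤ q η := hmin hηs
      have hξη : ξ = ‖ξ‖ • η := by
        rw [hη, smul_smul, mul_inv_cancel₀ hnξ.ne', one_smul]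
      have hqξ : q ξ = ‖ξ‖ ^ 2 * q η := by
        rw [hq]
        dsimp only
        conv_lhs => rw [hξη]
        simp only [map_smul, LinearMap.smul_apply, smul_eq_mul]
        ring
      rw [hqξ, mul_comm]
      exact mul_le_mul_of_nonneg_left hle (sq_nonneg _)
  -- radius of the sphere on which the field points inward
  set R : ℝ := Real.sqrt (max r 0 / m) + 1 with hR
  have hR_pos : 0 < R := by positivity
  have hR_sq : r ≤ m * R ^ 2 := by
    have h1 : max r 0 / m ≤ R ^ 2 := by
      have hs : Real.sqrt (max r 0 / m) ^ 2 = max r 0 / m :=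
        Real.sq_sqrt (div_nonneg (le_max_right _ _) hm_pos.le)
      have hle : Real.sqrt (max r 0 / m) ≤ R := by rw [hR]; linarith
      calc max r 0 / m = Real.sqrt (max r 0 / m) ^ 2 := hs.symm
        _ ≤ R ^ 2 := by gcongr
    calc r ≤ max r 0 := le_max_left _ _
      _ = m * (max r 0 / m) := by field_simp
      _ ≤ m * R ^ 2 := by gcongr
  have hsign : ∀ s ∈ Icc a b, ∀ ξ : EuclideanSpace ℝ (Fin n), ‖ξ‖ = R →
      inner ℝ (P s ξ) ξ ≤ 0 := by
    intro s hs ξ hξ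
    rw [hPinner]
    refine hcoer s hs (Φ ξ) ?_
    calc r ≤ m * R ^ 2 := hR_sq
      _ = m * ‖ξ‖ ^ 2 := by rw [hξ]
      _ ≤ q ξ := hq_lower ξ
  -- the retracted self-map and its fixed points (again packaged, to stay opaque)
  obtain ⟨T, hTc, hTnorm, hTzero⟩ :
      ∃ T : ℝ → EuclideanSpace ℝ (Fin n) → EuclideanSpace ℝ (Fin n),
        (Continuous fun p : ℝ × EuclideanSpace ℝ (Fin n) => T p.1 p.2) ∧ (∀ s ξ, ‖T s ξ‖ ≤ R) ∧
          ∀ s ∈ Icc a b, ∀ ξ, T s ξ = ξ → P s ξ = 0 :=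
    ⟨fun s ξ => (R / max R ‖ξ + P s ξ‖) • (ξ + P s ξ),
      (continuous_retract hR_pos).comp (continuous_snd.add hPc),
      fun s ξ => norm_retract_le hR_pos _,
      fun s hs ξ h => eq_zero_of_retract_add_eq hR_pos h (hsign s hs ξ)⟩
  -- coordinates: the parameter is the coordinate `none` of `Option (Fin n) → ℝ`
  set toE : (Option (Fin n) → ℝ) → EuclideanSpace ℝ (Fin n) := fun z =>
    WithLp.toLp 2 fun j => z (some j) with htoE
  have htoEc : Continuous toE :=
    (PiLp.continuous_toLp 2 _).comp (continuous_pi fun j => continuous_apply (some j))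
  set f : (Option (Fin n) → ℝ) → (Option (Fin n) → ℝ) := fun z i =>
    Option.elim i (z none) fun j => T (z none) (toE z) j with hf
  set lo : Option (Fin n) → ℝ := fun i => Option.elim i a fun _ => -R with hlo
  set hi : Option (Fin n) → ℝ := fun i => Option.elim i b fun _ => R with hhi
  have hlohi : lo ≤ hi := by
    intro i
    cases i with
    | none => exact hab
    | some j =>
      show -R ≤ R
      linarith
  have hfc : Continuous f := by
    refine continuous_pi fun i => ?_
    cases i with
    | none => exact continuous_apply none
    | some j =>
      show Continuous fun z : Option (Fin n) → ℝ => T (z none) (toE z) j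
      exact (EuclideanSpace.proj j).continuous.comp
        (hTc.comp ((continuous_apply none).prodMk htoEc))
  have hmaps : ∀ z, lo ≤ z → z ≤ hi → lo ≤ f z ∧ f z ≤ hi := by
    intro z hzlo hzhi
    have hcoord : ∀ j : Fin n, |T (z none) (toE z) j| ≤ R := fun j =>
      le_trans (by simpa using PiLp.norm_apply_le (T (z none) (toE z)) j) (hTnorm _ _)
    constructor
    · intro i
      cases i with
      | none => exact hzlo none
      | some j =>
        show -R ≤ T (z none) (toE z) j
        exact (abs_le.1 (hcoord j)).1
    · intro i
      cases i with
      | none => exact hzhi none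
      | some j =>
        show T (z none) (toE z) j ≤ R
        exact (abs_le.1 (hcoord j)).2
  have hpar : ∀ z, f z none = z none := fun z => rfl
  obtain ⟨C, hC, hconn, himg⟩ :=
    Literature.Topology.Euclidean.Browder.exists_isConnected_fixedPoints hlohi none hfc hmaps hpar
  -- transport the connected set of fixed points to `ℝ × X`
  set Ψ : (Option (Fin n) → ℝ) → ℝ × X := fun z => (z none, Φ (toE z)) with hΨ
  have hΨc : Continuous Ψ := (continuous_apply none).prodMk (Φ.continuous.comp htoEc)
  refine ⟨Ψ '' C, ?_, hconn.image Ψ hΨc.continuousOn, ?_⟩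
  · rintro _ ⟨z, hz, rfl⟩
    obtain ⟨hzlo, hzhi, hfz⟩ := hC hz
    have hs : z none ∈ Icc a b := ⟨hzlo none, hzhi none⟩
    refine ⟨hs, ?_⟩
    have hTfix : T (z none) (toE z) = toE z := by
      ext j
      exact congrFun hfz (some j)
    have hP0 : P (z none) (toE z) = 0 := hTzero _ hs _ hTfix
    show V (z none) (Φ (toE z)) = 0
    by_contra hVne
    have hpos := hB _ hVne
    have hzero : B (V (z none) (Φ (toE z))) (V (z none) (Φ (toE z))) = 0 := by
      have h := hPinner (z none) (toE z) (Φ.symm (V (z none) (Φ (toE z))))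
      rw [hP0, inner_zero_left, ContinuousLinearEquiv.apply_symm_apply] at h
      exact h.symm
    exact hpos.ne' hzero
  · rw [Set.image_image]
    exact himg

end Continuation

end Summit.AnomalousDissipation.AnomalousDissipation.Theorems.WindLineReachesCalm

end
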